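import Summits.HodgeConjecture.HodgeConjecture.Theses.SaitoKurokawaBridge

/-!
# Birth skeleton — piece `SaitoKurokawaHodgeClass` (item stmt-HodgeConjecture-3302; the GLP26 witness)

Two registered stubs and the kernel-checked composition
`SaitoKurokawaHodgeClass_of : stub_coversExist → stub_glpOnEveryCoverPair → SaitoKurokawaHodgeClass`.

* `stub_coversExist` — smooth projective Galois covers of `M̄_{1,17}` and `M̄_{2,14}` exist (Looijenga
  1994 / Boggi–Pikaart 2000; the tree's NAMED FACT `nonempty_stableCurvesModuliCover g n` at
  `(1,17)`, `(2,14)`: `3 ≤ 2g + n`); dischargeable from `(h : nonempty_stableCurvesModuliCover _ _)`.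
* `stub_glpOnEveryCoverPair` — the announced Gu–Lee–Prasanna Hodge isomorphism in canonical-carrier
  form on EVERY cover pair `(M, N)`: a rational `(17,17)`-class `κ` on `M.Z ⊗ N.Z` and invariant classes
  `a` of type `(17,0)`, `b` of type `(0,17)` with `κ ∪ fst*a ∪ snd*b ≠ 0` (transport of the Künneth
  class of the HS-morphism `H¹⁷(M̄_{1,17}) ⊇ s₁₈ → H¹⁷(M̄_{2,14})` to the covers; `a` = pull-back of
  `ω(f₁₈)`, non-zero because `M.Z → M̄_{1,17}` is dominant). [GLP26, announced; arXiv:2605.20453 p. 15]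
-/

set_option linter.dupNamespace false

open CategoryTheory MonoidalCategory
open Literature.AlgebraicGeometry Literature.AlgebraicGeometry.HodgeTheory
open Literature.AlgebraicTopology.SingularHomology

namespace Summit.HodgeConjecture.HodgeConjecture.Cruxes.ExtremeBridgeFailure.HodgeClass

open Summit.HodgeConjecture.HodgeConjecture.Theses.SaitoKurokawaBridge
open CartesianMonoidalCategory SemiCartesianMonoidalCategory

/-- STUB 1 (known: Looijenga / Boggi–Pikaart; the tree's named fact at `(1,17)` and `(2,14)`). -/
theorem stub_coversExist :
    Nonempty (Literature.AlgebraicGeometry.ModuliOfCurves.StableCurvesModuliCover ℂ 1 17) ∧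
      Nonempty (Literature.AlgebraicGeometry.ModuliOfCurves.StableCurvesModuliCover ℂ 2 14) := by
  sorry

/-- STUB 2 (GLP26 on every cover pair, canonical carriers). -/
theorem stub_glpOnEveryCoverPair :
    ∀ (M : Literature.AlgebraicGeometry.ModuliOfCurves.StableCurvesModuliCover ℂ 1 17)
      (N : Literature.AlgebraicGeometry.ModuliOfCurves.StableCurvesModuliCover ℂ 2 14),
      ∃ (κ : complexBetti (M.Z ⊗ N.Z) 34) (a : complexBetti M.Z 17) (b : complexBetti N.Z 17),
        IsRationalClass κ ∧ IsOfHodgeType 34 (M.Z ⊗ N.Z) 34 17 17 κ ∧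
        (∀ g : M.G, complexBetti.map (M.act g).hom 17 a = a) ∧ IsOfHodgeType 17 M.Z 17 17 0 a ∧
        (∀ g : N.G, complexBetti.map (N.act g).hom 17 b = b) ∧ IsOfHodgeType 17 N.Z 17 0 17 b ∧
        cupProduct (rfl : 51 + 17 = 68)
          (cupProduct (rfl : 34 + 17 = 51) κ (complexBetti.map (fst M.Z N.Z) 17 a))
          (complexBetti.map (snd M.Z N.Z) 17 b) ≠ 0 := by
  sorry

/-- COMPOSITION (kernel-checked, no sorry of its own): the two stubs give item 3302 BY NAME. -/
theorem SaitoKurokawaHodgeClass_of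
    (h1 : Nonempty (Literature.AlgebraicGeometry.ModuliOfCurves.StableCurvesModuliCover ℂ 1 17) ∧
      Nonempty (Literature.AlgebraicGeometry.ModuliOfCurves.StableCurvesModuliCover ℂ 2 14))
    (h2 : ∀ (M : Literature.AlgebraicGeometry.ModuliOfCurves.StableCurvesModuliCover ℂ 1 17)
      (N : Literature.AlgebraicGeometry.ModuliOfCurves.StableCurvesModuliCover ℂ 2 14),
      ∃ (κ : complexBetti (M.Z ⊗ N.Z) 34) (a : complexBetti M.Z 17) (b : complexBetti N.Z 17),
        IsRationalClass κ ∧ IsOfHodgeType 34 (M.Z ⊗ N.Z) 34 17 17 κ ∧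
        (∀ g : M.G, complexBetti.map (M.act g).hom 17 a = a) ∧ IsOfHodgeType 17 M.Z 17 17 0 a ∧
        (∀ g : N.G, complexBetti.map (N.act g).hom 17 b = b) ∧ IsOfHodgeType 17 N.Z 17 0 17 b ∧
        cupProduct (rfl : 51 + 17 = 68)
          (cupProduct (rfl : 34 + 17 = 51) κ (complexBetti.map (fst M.Z N.Z) 17 a))
          (complexBetti.map (snd M.Z N.Z) 17 b) ≠ 0) :
    SaitoKurokawaHodgeClass := by
  obtain ⟨⟨M⟩, ⟨N⟩⟩ := h1
  obtain ⟨κ, a, b, hrat, hκ, haG, ha, hbG, hb, hne⟩ := h2 M N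
  exact ⟨M, N, κ, a, b, hrat, hκ, haG, ha, hbG, hb, hne⟩

end Summit.HodgeConjecture.HodgeConjecture.Cruxes.ExtremeBridgeFailure.HodgeClass
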